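import Mathlib
import Literature.MathematicalPhysics.StatisticalMechanics.BarlowStacking
import HarnessLib

/-!
# Index boxes for line `LayerChain` v4 (crux `StackingLiminf`, stmt-Ventures-19145): two points of a
# Barlow stacking that are close in space have close INDICES

Route `StickyWulffConstant` of the venture `Summits/Ventures/Crystal3D` (cell `crystal3d-full`).
For a Hägg word `σ` (letters `±1`):
* `abs_haggLabel_sub_le` — the letter walk is 1-Lipschitz: `|L(m) − L(n)| ≤ |m − n|`;
* **`idx_sub_le_of_near`** — if `P = barlowPos 1 √(2/3) σ k a b` and `P' = barlowPos 1 √(2/3) σ k' a' b'`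
  satisfy `|P'₂ − P₂| < 2K`, `|P'₀ − P₀| < 2K + 2L`, `|P'₁ − P₁| < 2K + 2L` with `1 ≤ K ≤ L`, then
  `|k' − k| ≤ 3K`, `|a' − a| ≤ 9L`, `|b' − b| ≤ 6L` (as real numbers).
This converts the real-space window of the bad-mass step of stub (C) `stub_plateauBound` into a
displacement box in index space `ℤ³`, where the generic pair count `card_pairs_le`
(`…StackingLiminfGridPairCount`) applies.
WHAT THIS IS NOT: not stub (C); rung F-C1 not moved.
-/

noncomputable section

namespace Summit.Ventures.Crystal3D.Theorems.PlateauHeight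

open Literature.MathematicalPhysics.StatisticalMechanics

/-- The letter walk of a Hägg word is 1-Lipschitz (natural-number form). -/
theorem abs_haggLabel_add_natCast_sub_le {σ : ℤ → ℤ} (hσ : IsHaggSeq σ) (m : ℤ) (n : ℕ) :
    |haggLabel σ (m + n) - haggLabel σ m| ≤ n := by
  induction n with
  | zero => simp
  | succ n ih =>
    rw [Nat.cast_succ, ← add_assoc, haggLabel_succ]
    have h1 : |σ (m + n)| = 1 := by
      rcases hσ (m + n) with h | h <;> simp [h]
    calc |haggLabel σ (m + ↑n) + σ (m + ↑n) - haggLabel σ m|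
        = |(haggLabel σ (m + ↑n) - haggLabel σ m) + σ (m + ↑n)| := by ring_nf
      _ ≤ |haggLabel σ (m + ↑n) - haggLabel σ m| + |σ (m + ↑n)| := abs_add_le _ _
      _ ≤ n + 1 := by rw [h1]; linarith

/-- **The letter walk is 1-Lipschitz**: `|L(m) − L(n)| ≤ |m − n|`. -/
theorem abs_haggLabel_sub_le {σ : ℤ → ℤ} (hσ : IsHaggSeq σ) (m n : ℤ) :
    |haggLabel σ m - haggLabel σ n| ≤ |m - n| := by
  rcases le_total n m with h | h
  · obtain ⟨d, hd⟩ := Int.eq_ofNat_of_zero_le (sub_nonneg.2 h)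
    have hm : m = n + (d : ℤ) := by linarith
    rw [hm, show |n + (d : ℤ) - n| = (d : ℤ) by simp]
    exact abs_haggLabel_add_natCast_sub_le hσ n d
  · obtain ⟨d, hd⟩ := Int.eq_ofNat_of_zero_le (sub_nonneg.2 h)
    have hn : n = m + (d : ℤ) := by linarith
    rw [hn, show |m - (m + (d : ℤ))| = (d : ℤ) by rw [abs_sub_comm]; simp,
      abs_sub_comm]
    exact abs_haggLabel_add_natCast_sub_le hσ m d

/-- `√(2/3) > 4/5`. -/
theorem four_fifths_lt_sqrt_two_thirds : (4 : ℝ) / 5 < Real.sqrt (2 / 3) := by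
  rw [show (4 : ℝ) / 5 = Real.sqrt ((4 / 5) ^ 2) by rw [Real.sqrt_sq (by norm_num)]]
  exact Real.sqrt_lt_sqrt (by norm_num) (by norm_num)

/-- `√3 > 17/10`. -/
theorem seventeen_tenths_lt_sqrt_three : (17 : ℝ) / 10 < Real.sqrt 3 := by
  rw [show (17 : ℝ) / 10 = Real.sqrt ((17 / 10) ^ 2) by rw [Real.sqrt_sq (by norm_num)]]
  exact Real.sqrt_lt_sqrt (by norm_num) (by norm_num)

/-- **Close points have close indices.**  For a Hägg word `σ` and `1 ≤ K ≤ L`: if two points of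
`barlowStacking 1 √(2/3) σ` differ by less than `2K` in height and by less than `2K + 2L` in each
lateral coordinate, their indices differ by at most `3K` (layer), `9L`, `6L` (in-layer). -/
theorem idx_sub_le_of_near {σ : ℤ → ℤ} (hσ : IsHaggSeq σ) {K L : ℝ} (hK : 1 ≤ K) (hKL : K ≤ L)
    (k a b k' a' b' : ℤ)
    (h2 : |(barlowPos 1 (Real.sqrt (2 / 3)) σ k' a' b') 2 - (barlowPos 1 (Real.sqrt (2 / 3)) σ k a b) 2|
      < 2 * K)
    (h0 : |(barlowPos 1 (Real.sqrt (2 / 3)) σ k' a' b') 0 - (barlowPos 1 (Real.sqrt (2 / 3)) σ k a b) 0|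
      < 2 * K + 2 * L)
    (h1 : |(barlowPos 1 (Real.sqrt (2 / 3)) σ k' a' b') 1 - (barlowPos 1 (Real.sqrt (2 / 3)) σ k a b) 1|
      < 2 * K + 2 * L) :
    |((k' : ℝ) - k)| ≤ 3 * K ∧ |((a' : ℝ) - a)| ≤ 9 * L ∧ |((b' : ℝ) - b)| ≤ 6 * L := by
  set h : ℝ := Real.sqrt (2 / 3) with hh_def
  have hh : (4 : ℝ) / 5 < h := four_fifths_lt_sqrt_two_thirds
  have hr3 : (17 : ℝ) / 10 < Real.sqrt 3 := seventeen_tenths_lt_sqrt_three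
  simp only [barlowPos_apply_zero, barlowPos_apply_one, barlowPos_apply_two, one_mul] at h0 h1 h2
  set r3 : ℝ := Real.sqrt 3 with hr3_def
  -- abbreviations
  set dk : ℝ := (k' : ℝ) - k with hdk
  set da : ℝ := (a' : ℝ) - a with hda
  set db : ℝ := (b' : ℝ) - b with hdb
  set dL : ℝ := ((haggLabel σ k' : ℤ) : ℝ) - haggLabel σ k with hdL
  -- the letter difference
  have hL : |dL| ≤ |dk| := by
    have := abs_haggLabel_sub_le hσ k' k
    rw [hdL, hdk]
    exact_mod_cast this
  -- layer difference: `|Δk| h < 2K`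
  have hk : |dk| ≤ 3 * K := by
    have e : (k' : ℝ) * h - k * h = dk * h := by rw [hdk]; ring
    rw [e, abs_mul, abs_of_pos (show (0 : ℝ) < h by linarith)] at h2
    have hdk0 := abs_nonneg dk
    have : |dk| * (4 / 5) ≤ |dk| * h := mul_le_mul_of_nonneg_left hh.le hdk0
    nlinarith
  have hKL3 : |dk| ≤ 3 * L := hk.trans (by linarith)
  -- second in-layer index: `ΔP₁ = (√3/2)(Δb + ΔL/3)`
  have hX : |db + dL / 3| < 5 * L := by
    have e : r3 / 2 * ((b' : ℝ) + haggLabel σ k' / 3) - r3 / 2 * (b + haggLabel σ k / 3) =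
        r3 / 2 * (db + dL / 3) := by rw [hdb, hdL]; ring
    rw [e, abs_mul, abs_of_pos (show (0 : ℝ) < r3 / 2 by linarith)] at h1
    have hX0 := abs_nonneg (db + dL / 3)
    have : 17 / 20 * |db + dL / 3| ≤ r3 / 2 * |db + dL / 3| :=
      mul_le_mul_of_nonneg_right (by linarith) hX0
    nlinarith
  have hb : |db| ≤ 6 * L := by
    have h4 : |db| ≤ |db + dL / 3| + |dL / 3| := by
      have := abs_sub_le (db + dL / 3) (dL / 3) 0
      have := abs_add_le (db + dL / 3) (-(dL / 3))
      rw [show db + dL / 3 + -(dL / 3) = db by ring, abs_neg] at this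
      exact this
    rw [abs_div, abs_of_pos (by norm_num : (0 : ℝ) < 3)] at h4
    linarith
  refine ⟨hk, ?_, hb⟩
  -- first in-layer index: `ΔP₀ = Δa + Δb/2 + ΔL/2`
  have e : (a' : ℝ) + b' / 2 + haggLabel σ k' / 2 - (a + b / 2 + haggLabel σ k / 2) =
      da + (db / 2 + dL / 2) := by rw [hda, hdb, hdL]; ring
  rw [e] at h0
  have h4 : |da| ≤ |da + (db / 2 + dL / 2)| + |db / 2 + dL / 2| := by
    have := abs_add_le (da + (db / 2 + dL / 2)) (-(db / 2 + dL / 2))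
    rw [show da + (db / 2 + dL / 2) + -(db / 2 + dL / 2) = da by ring, abs_neg] at this
    exact this
  have h5 := abs_add_le (db / 2) (dL / 2)
  rw [abs_div, abs_div, abs_of_pos (by norm_num : (0 : ℝ) < 2)] at h5
  linarith

end Summit.Ventures.Crystal3D.Theorems.PlateauHeight

end
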